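import Summits.Ventures.PercRepro.C026ProdCSGluing
import Summits.Ventures.PercRepro.C026ProdCFMulti
import Summits.Ventures.PercRepro.C026ProdCFComponents

/-!
# THEOREM PROD for `k` parts: (CS) on a multi-gluing from (CS) + (SR) on every colour class (p5, gen 16)

mine-3's COROLLARY 1 (`proofs/MINE3-PRODUCT.md` §2) in the general form of `C026ProdCFMulti`: for an
`ι`-colouring `col` of the edges of `G` with every non-mark monochromatic (`IsGluingMulti`), if every
colour class `G.colClassGraph col i` satisfies (CS), (SR_a) and (SR_b), then `G` satisfies (CS).
Unlike (CF), (CS) + (SR) is NOT preserved under gluing (mine-3 M3-SR: (SR) fails on products), so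
the two-part theorem cannot be iterated: the `k` classes are fed to `prod_cs_counts` at once. For that
**the six counts of `G` are the products over the colour classes** (`apartCount_colouring`, …),
obtained from the two-part products (`apartCount_gluing`, …) by induction on the set of colours with
the relabelling invariance of the counts (`apartCount_relabel`, …; the edgeless graph has every count
`1` when the marks are distinct). With coinciding marks (CS) is trivial (`N² = ∅`).

* `apart_relabel_iff`, `isoMark_relabel_iff`, `isBot_relabel_iff`; the six `_relabel` count lemmas;
* `count_colouring` — the generic induction (a count that multiplies over gluings, is
  relabel-invariant and is `1` on the edgeless graph is the product over the colour classes);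
* the six `_colouring` product identities;
* **`csCounts_of_colouring`** — COROLLARY 1 for `k` parts; `csCounts_of_components` — on the
  component colouring; `csIneq_of_components` in the tree's vocabulary (`CSIneq` of `C026FactorTwo`).
-/

namespace PercRepro

open Finset

namespace MultiGraph

/-! ### Relabelling invariance of the six events and counts -/

section RelabelCounts

variable {V E₁ E₂ : Type*} {G₁ : MultiGraph V E₁} {G₂ : MultiGraph V E₂} {ε : E₁ ≃ E₂}

/-- `Apart` is invariant under relabelling. -/
theorem apart_relabel_iff (h : IsRelabel G₁ G₂ ε) (ω : Config E₂) (a b c : V) :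
    G₁.Apart (pullConfig ε ω) a b c ↔ G₂.Apart ω a b c := by
  unfold Apart
  rw [conn_compl_relabel_iff h, conn_compl_relabel_iff h, cluster_compl_relabel h,
    connAvoid_relabel_iff h]

/-- `IsoMark` is invariant under relabelling. -/
theorem isoMark_relabel_iff (h : IsRelabel G₁ G₂ ε) (ω : Config E₂) (m x y : V) :
    G₁.IsoMark (pullConfig ε ω) m x y ↔ G₂.IsoMark ω m x y := by
  unfold IsoMark
  rw [conn_relabel_iff h, conn_relabel_iff h]

/-- `IsBot` is invariant under relabelling. -/
theorem isBot_relabel_iff (h : IsRelabel G₁ G₂ ε) (ω : Config E₂) (a b c : V) :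
    G₁.IsBot (pullConfig ε ω) a b c ↔ G₂.IsBot ω a b c := by
  unfold IsBot
  rw [conn_relabel_iff h, conn_relabel_iff h, conn_relabel_iff h]

open Classical in
/-- `T` is relabel-invariant. -/
theorem apartCount_relabel [Fintype E₁] [Fintype E₂] (h : IsRelabel G₁ G₂ ε) (a b c : V) :
    G₁.apartCount a b c = G₂.apartCount a b c := by
  unfold apartCount
  rw [card_filter_relabel ε]
  simp only [apart_relabel_iff h]

open Classical in
/-- `P` is relabel-invariant. -/
theorem apartIsoBCount_relabel [Fintype E₁] [Fintype E₂] (h : IsRelabel G₁ G₂ ε) (a b c : V) :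
    G₁.apartIsoBCount a b c = G₂.apartIsoBCount a b c := by
  unfold apartIsoBCount
  rw [card_filter_relabel ε]
  simp only [apart_relabel_iff h, isoMark_relabel_iff h]

open Classical in
/-- `Q` is relabel-invariant. -/
theorem apartIsoACount_relabel [Fintype E₁] [Fintype E₂] (h : IsRelabel G₁ G₂ ε) (a b c : V) :
    G₁.apartIsoACount a b c = G₂.apartIsoACount a b c := by
  unfold apartIsoACount
  rw [card_filter_relabel ε]
  simp only [apart_relabel_iff h, isoMark_relabel_iff h]

open Classical in
/-- `Z` is relabel-invariant. -/
theorem apartBotCount_relabel [Fintype E₁] [Fintype E₂] (h : IsRelabel G₁ G₂ ε) (a b c : V) :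
    G₁.apartBotCount a b c = G₂.apartBotCount a b c := by
  unfold apartBotCount
  rw [card_filter_relabel ε]
  simp only [apart_relabel_iff h, isBot_relabel_iff h]

open Classical in
/-- `Mₐ` is relabel-invariant. -/
theorem isoBCount_relabel [Fintype E₁] [Fintype E₂] (h : IsRelabel G₁ G₂ ε) (a b c : V) :
    G₁.isoBCount a b c = G₂.isoBCount a b c := by
  unfold isoBCount
  rw [card_filter_relabel ε]
  simp only [isoMark_relabel_iff h]

open Classical in
/-- `M_b` is relabel-invariant. -/
theorem isoACount_relabel [Fintype E₁] [Fintype E₂] (h : IsRelabel G₁ G₂ ε) (a b c : V) :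
    G₁.isoACount a b c = G₂.isoACount a b c := by
  unfold isoACount
  rw [card_filter_relabel ε]
  simp only [isoMark_relabel_iff h]

end RelabelCounts

/-! ### The edgeless graph with distinct marks -/

section Edgeless

variable {V E : Type*} [Fintype E] [IsEmpty E] (G : MultiGraph V E)

omit [Fintype E] in
/-- In the edgeless graph, connectivity is equality. -/
theorem conn_iff_eq_of_isEmpty (ω : Config E) (x y : V) : G.Conn ω x y ↔ x = y :=
  ⟨fun h => (eq_of_conn_of_forall_eq_false (fun e => isEmptyElim e) h).symm,
    fun h => h ▸ Conn.refl _ _ _⟩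

omit [Fintype E] in
/-- A count over the one-configuration cube of an edgeless graph with a true predicate is `1`
(for ANY `Fintype` / `DecidablePred` instances, passed explicitly so that `rw` unifies them). -/
theorem card_filter_isEmpty (inst : Fintype (Config E)) (P : Config E → Prop)
    (instP : DecidablePred P) (hP : ∀ ω, P ω) :
    (@Finset.filter _ P instP (@univ _ inst)).card = 1 := by
  rw [Finset.filter_true_of_mem fun ω _ => hP ω, Finset.card_univ]
  exact Fintype.card_unique

variable {G}

open Classical in
/-- The six counts of the edgeless graph with distinct marks are all `1`. -/
theorem counts_isEmpty {a b c : V} (hab : a ≠ b) (hac : a ≠ c) (hbc : b ≠ c) :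
    G.apartCount a b c = 1 ∧ G.apartIsoBCount a b c = 1 ∧ G.apartIsoACount a b c = 1 ∧
      G.apartBotCount a b c = 1 ∧ G.isoBCount a b c = 1 ∧ G.isoACount a b c = 1 := by
  have hApart : ∀ ω : Config E, G.Apart ω a b c := fun ω =>
    ⟨fun h => hac ((conn_iff_eq_of_isEmpty G _ _ _).mp h).symm,
      fun h => hbc ((conn_iff_eq_of_isEmpty G _ _ _).mp h).symm,
      fun h => hab ((conn_iff_eq_of_isEmpty G _ _ _).mp h.conn)⟩
  have hB : ∀ ω : Config E, G.IsoMark ω b a c := fun ω =>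
    ⟨fun h => hab ((conn_iff_eq_of_isEmpty G _ _ _).mp h).symm,
      fun h => hbc ((conn_iff_eq_of_isEmpty G _ _ _).mp h)⟩
  have hA : ∀ ω : Config E, G.IsoMark ω a b c := fun ω =>
    ⟨fun h => hab ((conn_iff_eq_of_isEmpty G _ _ _).mp h),
      fun h => hac ((conn_iff_eq_of_isEmpty G _ _ _).mp h)⟩
  have hBot : ∀ ω : Config E, G.IsBot ω a b c := fun ω =>
    ⟨fun h => hab ((conn_iff_eq_of_isEmpty G _ _ _).mp h),
      fun h => hac ((conn_iff_eq_of_isEmpty G _ _ _).mp h),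
      fun h => hbc ((conn_iff_eq_of_isEmpty G _ _ _).mp h)⟩
  unfold apartCount apartIsoBCount apartIsoACount apartBotCount isoBCount isoACount
  refine ⟨?_, ?_, ?_, ?_, ?_, ?_⟩
  · rw [card_filter_isEmpty _ _ _ fun ω => hApart ω]; norm_num
  · rw [card_filter_isEmpty _ (fun ω => G.Apart ω a b c ∧ G.IsoMark ω b a c) _
      fun ω => ⟨hApart ω, hB ω⟩]; norm_num
  · rw [card_filter_isEmpty _ (fun ω => G.Apart ω a b c ∧ G.IsoMark ω a b c) _
      fun ω => ⟨hApart ω, hA ω⟩]; norm_num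
  · rw [card_filter_isEmpty _ (fun ω => G.Apart ω a b c ∧ G.IsBot ω a b c) _
      fun ω => ⟨hApart ω, hBot ω⟩]; norm_num
  · rw [card_filter_isEmpty _ _ _ fun ω => hB ω]; norm_num
  · rw [card_filter_isEmpty _ _ _ fun ω => hA ω]; norm_num

end Edgeless

/-! ### The generic product over a colouring -/

section Colouring

universe v

variable {V : Type*}

/-- **The generic induction**: a count `cnt` of marked multigraphs on `V` (any finite edge type in
the universe `v`) that multiplies over 3-terminal gluings, is invariant under relabelling and is
`1` on the edgeless graph is, on a multi-gluing, the product of its values on the colour classes. -/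
theorem count_colouring {ι : Type*} [DecidableEq ι] (a b c : V)
    (cnt : ∀ (E : Type v) [Fintype E], MultiGraph V E → ℤ)
    (hglue : ∀ (E : Type v) [Fintype E] (G : MultiGraph V E) (side : E → Bool),
      G.IsGluing a b c side → cnt E G = cnt _ (G.part side true) * cnt _ (G.part side false))
    (hrel : ∀ (E₁ E₂ : Type v) [Fintype E₁] [Fintype E₂] (G₁ : MultiGraph V E₁)
      (G₂ : MultiGraph V E₂) (ε : E₁ ≃ E₂), IsRelabel G₁ G₂ ε → cnt E₁ G₁ = cnt E₂ G₂)
    (hempty : ∀ (E : Type v) [Fintype E] [IsEmpty E] (G : MultiGraph V E), cnt E G = 1)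
    (S : Finset ι) :
    ∀ {E : Type v} [Fintype E] (G : MultiGraph V E) (col : E → ι),
      G.IsGluingMulti a b c col → (∀ e, col e ∈ S) →
      cnt E G = ∏ i ∈ S, cnt _ (G.colClassGraph col i) := by
  induction S using Finset.induction_on with
  | empty =>
    intro E _ G col _ hS
    haveI : IsEmpty E := ⟨fun e => by simpa using hS e⟩
    rw [Finset.prod_empty]
    exact hempty E G
  | insert i S hi ih =>
    intro E _ G col hg hS
    let side : E → Bool := fun e => decide (col e = i)
    have hglue' : G.IsGluing a b c side := by
      intro v hva hvb hvc e e' he he'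
      simp only [side, hg v hva hvb hvc e e' he he']
    rw [Finset.prod_insert hi, hglue E G side hglue']
    congr 1
    · have hrel' : IsRelabel (G.part side true) (G.colClassGraph col i)
          (Equiv.subtypeEquivRight fun e => by simp [side]) := fun e => ⟨rfl, rfl⟩
      exact hrel _ _ _ _ _ hrel'
    · rw [ih (G.part side false) (fun e => col e.1) (hg.part side false) ?_]
      · refine Finset.prod_congr rfl fun j hj => ?_
        have hji : j ≠ i := fun hji => hi (hji ▸ hj)
        have hrel' : IsRelabel ((G.part side false).colClassGraph (fun e => col e.1) j)
            (G.colClassGraph col j)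
            (Equiv.subtypeSubtypeEquivSubtype fun {e} (he : col e = j) => by
              simp [side, he, hji]) := fun e => ⟨rfl, rfl⟩
        exact hrel _ _ _ _ _ hrel'
      · intro e
        have he := hS e.1
        have hne : col e.1 ≠ i := by
          have := e.2
          simpa [side] using this
        exact Finset.mem_of_mem_insert_of_ne he hne

variable {E ι : Type*} [Fintype E] [DecidableEq ι] {G : MultiGraph V E} {a b c : V} {col : E → ι}

open Classical in
/-- `T` is the product over the colour classes (distinct marks). -/
theorem apartCount_colouring (hg : G.IsGluingMulti a b c col) {S : Finset ι} (hS : ∀ e, col e ∈ S)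
    (hab : a ≠ b) (hac : a ≠ c) (hbc : b ≠ c) :
    G.apartCount a b c = ∏ i ∈ S, (G.colClassGraph col i).apartCount a b c :=
  count_colouring a b c (fun _ _ G => G.apartCount a b c)
    (fun _ _ _ _ hg => apartCount_gluing hg) (fun _ _ _ _ _ _ _ h => apartCount_relabel h a b c)
    (fun _ _ _ _ => (counts_isEmpty hab hac hbc).1) S G col hg hS

open Classical in
/-- `P` is the product over the colour classes (distinct marks). -/
theorem apartIsoBCount_colouring (hg : G.IsGluingMulti a b c col) {S : Finset ι}
    (hS : ∀ e, col e ∈ S) (hab : a ≠ b) (hac : a ≠ c) (hbc : b ≠ c) :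
    G.apartIsoBCount a b c = ∏ i ∈ S, (G.colClassGraph col i).apartIsoBCount a b c :=
  count_colouring a b c (fun _ _ G => G.apartIsoBCount a b c)
    (fun _ _ _ _ hg => apartIsoBCount_gluing hg)
    (fun _ _ _ _ _ _ _ h => apartIsoBCount_relabel h a b c)
    (fun _ _ _ _ => (counts_isEmpty hab hac hbc).2.1) S G col hg hS

open Classical in
/-- `Q` is the product over the colour classes (distinct marks). -/
theorem apartIsoACount_colouring (hg : G.IsGluingMulti a b c col) {S : Finset ι}
    (hS : ∀ e, col e ∈ S) (hab : a ≠ b) (hac : a ≠ c) (hbc : b ≠ c) :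
    G.apartIsoACount a b c = ∏ i ∈ S, (G.colClassGraph col i).apartIsoACount a b c :=
  count_colouring a b c (fun _ _ G => G.apartIsoACount a b c)
    (fun _ _ _ _ hg => apartIsoACount_gluing hg)
    (fun _ _ _ _ _ _ _ h => apartIsoACount_relabel h a b c)
    (fun _ _ _ _ => (counts_isEmpty hab hac hbc).2.2.1) S G col hg hS

open Classical in
/-- `Z` is the product over the colour classes (distinct marks). -/
theorem apartBotCount_colouring (hg : G.IsGluingMulti a b c col) {S : Finset ι}
    (hS : ∀ e, col e ∈ S) (hab : a ≠ b) (hac : a ≠ c) (hbc : b ≠ c) :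
    G.apartBotCount a b c = ∏ i ∈ S, (G.colClassGraph col i).apartBotCount a b c :=
  count_colouring a b c (fun _ _ G => G.apartBotCount a b c)
    (fun _ _ _ _ hg => apartBotCount_gluing hg)
    (fun _ _ _ _ _ _ _ h => apartBotCount_relabel h a b c)
    (fun _ _ _ _ => (counts_isEmpty hab hac hbc).2.2.2.1) S G col hg hS

open Classical in
/-- `Mₐ` is the product over the colour classes (distinct marks). -/
theorem isoBCount_colouring (hg : G.IsGluingMulti a b c col) {S : Finset ι} (hS : ∀ e, col e ∈ S)
    (hab : a ≠ b) (hac : a ≠ c) (hbc : b ≠ c) :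
    G.isoBCount a b c = ∏ i ∈ S, (G.colClassGraph col i).isoBCount a b c :=
  count_colouring a b c (fun _ _ G => G.isoBCount a b c)
    (fun _ _ _ _ hg => isoBCount_gluing hg) (fun _ _ _ _ _ _ _ h => isoBCount_relabel h a b c)
    (fun _ _ _ _ => (counts_isEmpty hab hac hbc).2.2.2.2.1) S G col hg hS

open Classical in
/-- `M_b` is the product over the colour classes (distinct marks). -/
theorem isoACount_colouring (hg : G.IsGluingMulti a b c col) {S : Finset ι} (hS : ∀ e, col e ∈ S)
    (hab : a ≠ b) (hac : a ≠ c) (hbc : b ≠ c) :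
    G.isoACount a b c = ∏ i ∈ S, (G.colClassGraph col i).isoACount a b c :=
  count_colouring a b c (fun _ _ G => G.isoACount a b c)
    (fun _ _ _ _ hg => isoACount_gluing hg) (fun _ _ _ _ _ _ _ h => isoACount_relabel h a b c)
    (fun _ _ _ _ => (counts_isEmpty hab hac hbc).2.2.2.2.2) S G col hg hS

/-! ### (CS) with coinciding marks, and the theorem -/

open Classical in
/-- With two coinciding marks `N² = ∅`, so (CS) holds trivially. -/
theorem csCounts_of_marks_eq (G : MultiGraph V E) {a b c : V} (h : a = b ∨ a = c ∨ b = c) :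
    G.CSCounts a b c := by
  rw [csCounts_iff_nTwo]
  have h0 : (univ.filter fun ω : Config E => G.NTwo ω a b c) = ∅ := by
    refine Finset.filter_eq_empty_iff.mpr fun ω _ hω => ?_
    obtain ⟨hab, hca, hcb, hav⟩ := hω
    rcases h with rfl | rfl | rfl
    · exact hav (Relation.ReflTransGen.refl)
    · exact hca (Conn.refl _ _ _)
    · exact hcb (Conn.refl _ _ _)
  rw [h0, Finset.card_empty]
  positivity

open Classical in
/-- **THEOREM PROD for `k` parts** (mine-3's Corollary 1 in general form): on a multi-gluing with
colours in `S`, (CS) + (SR_a) + (SR_b) on every colour class gives (CS) on `G`. -/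
theorem csCounts_of_colouring (hg : G.IsGluingMulti a b c col) {S : Finset ι} (hS : ∀ e, col e ∈ S)
    (h : ∀ i ∈ S, (G.colClassGraph col i).CSCounts a b c ∧ (G.colClassGraph col i).SRa a b c ∧
      (G.colClassGraph col i).SRb a b c) :
    G.CSCounts a b c := by
  by_cases hdeg : a = b ∨ a = c ∨ b = c
  · exact csCounts_of_marks_eq G hdeg
  push Not at hdeg
  obtain ⟨hab, hac, hbc⟩ := hdeg
  have key := ProdCS.prod_cs_counts S (fun i => (G.colClassGraph col i).genC a b c)
    fun i hi => memKC_genC (h i hi).1 (h i hi).2.1 (h i hi).2.2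
  have ht : ∀ i, ((G.colClassGraph col i).genC a b c).t =
      ((G.colClassGraph col i).apartCount a b c : ℝ) :=
    fun i => by simp only [ProdCS.GenC.t, genC]; push_cast; ring
  simp only [ht] at key
  simp only [genC] at key
  push_cast at key
  have e1 : ∏ i ∈ S, (((G.colClassGraph col i).apartBotCount a b c : ℝ) +
      (((G.colClassGraph col i).apartIsoBCount a b c : ℝ) -
        ((G.colClassGraph col i).apartBotCount a b c : ℝ))) =
      ∏ i ∈ S, ((G.colClassGraph col i).apartIsoBCount a b c : ℝ) :=
    Finset.prod_congr rfl fun i _ => by ring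
  have e2 : ∏ i ∈ S, (((G.colClassGraph col i).apartBotCount a b c : ℝ) +
      (((G.colClassGraph col i).apartIsoACount a b c : ℝ) -
        ((G.colClassGraph col i).apartBotCount a b c : ℝ))) =
      ∏ i ∈ S, ((G.colClassGraph col i).apartIsoACount a b c : ℝ) :=
    Finset.prod_congr rfl fun i _ => by ring
  have e3 : ∏ i ∈ S, (((G.colClassGraph col i).apartCount a b c : ℝ) +
      (((G.colClassGraph col i).isoBCount a b c : ℝ) -
        ((G.colClassGraph col i).apartCount a b c : ℝ))) =
      ∏ i ∈ S, ((G.colClassGraph col i).isoBCount a b c : ℝ) :=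
    Finset.prod_congr rfl fun i _ => by ring
  have e4 : ∏ i ∈ S, (((G.colClassGraph col i).apartCount a b c : ℝ) +
      (((G.colClassGraph col i).isoACount a b c : ℝ) -
        ((G.colClassGraph col i).apartCount a b c : ℝ))) =
      ∏ i ∈ S, ((G.colClassGraph col i).isoACount a b c : ℝ) :=
    Finset.prod_congr rfl fun i _ => by ring
  rw [e1, e2, e3, e4] at key
  unfold CSCounts
  rw [apartCount_colouring hg hS hab hac hbc, apartIsoBCount_colouring hg hS hab hac hbc,
    apartIsoACount_colouring hg hS hab hac hbc, apartBotCount_colouring hg hS hab hac hbc,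
    isoBCount_colouring hg hS hab hac hbc, isoACount_colouring hg hS hab hac hbc]
  have key' : ((((∏ i ∈ S, (G.colClassGraph col i).apartCount a b c) -
      (∏ i ∈ S, (G.colClassGraph col i).apartIsoBCount a b c) -
      (∏ i ∈ S, (G.colClassGraph col i).apartIsoACount a b c) +
      ∏ i ∈ S, (G.colClassGraph col i).apartBotCount a b c) ^ 2 : ℤ) : ℝ) ≤
      ((((∏ i ∈ S, (G.colClassGraph col i).isoBCount a b c) -
        ∏ i ∈ S, (G.colClassGraph col i).apartCount a b c) *
        ((∏ i ∈ S, (G.colClassGraph col i).isoACount a b c) -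
        ∏ i ∈ S, (G.colClassGraph col i).apartCount a b c) : ℤ) : ℝ) := by
    push_cast
    exact key
  exact_mod_cast key'

open Classical in
/-- **Corollary 1 on the component colouring**: (CS) + (SR_a) + (SR_b) on every component core
`H_Γ` (and on the single mark–mark edges, which are classes of their own) gives (CS) on `G`. -/
theorem csCounts_of_components (a b c : V)
    (h : ∀ i, (G.colClassGraph (G.compColour a b c) i).CSCounts a b c ∧
      (G.colClassGraph (G.compColour a b c) i).SRa a b c ∧
      (G.colClassGraph (G.compColour a b c) i).SRb a b c) :
    G.CSCounts a b c :=
  csCounts_of_colouring (isGluingMulti_compColour a b c)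
    (S := univ.image (G.compColour a b c)) (fun e => Finset.mem_image_of_mem _ (Finset.mem_univ e))
    fun i _ => h i

open Classical in
/-- **Corollary 1 on the component colouring, with the conclusion in the tree's vocabulary**
(`CSIneq` of `C026FactorTwo`, for any `DecidableEq E`; the classes' hypotheses in the six-count form
`CSCounts`, which is `CSIneq` by `csIneq_iff_csCounts`). -/
theorem csIneq_of_components (a b c : V)
    (h : ∀ i, (G.colClassGraph (G.compColour a b c) i).CSCounts a b c ∧
      (G.colClassGraph (G.compColour a b c) i).SRa a b c ∧
      (G.colClassGraph (G.compColour a b c) i).SRb a b c) (inst : DecidableEq E) :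
    @CSIneq V E G _ inst a b c := by
  have key : G.CSIneq a b c := (csIneq_iff_csCounts a b c).mpr (csCounts_of_components a b c h)
  convert key using 2

open Classical in
/-- **Corollary 1, the (2×) reading**: (CS) + (SR_a) + (SR_b) on every component core gives mine-3's
(2×) on `G`. -/
theorem twoTimes_of_components (a b c : V)
    (h : ∀ i, (G.colClassGraph (G.compColour a b c) i).CSCounts a b c ∧
      (G.colClassGraph (G.compColour a b c) i).SRa a b c ∧
      (G.colClassGraph (G.compColour a b c) i).SRb a b c) :
    G.TwoTimes a b c :=
  twoTimes_of_csCounts (csCounts_of_components a b c h)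

open Classical in
/-- **Corollary 1, the C-026 reading**: (CS) + (SR_a) + (SR_b) on every component core gives (CF)
on `G`. -/
theorem slackCF_nonneg_of_components_cs (a b c : V)
    (h : ∀ i, (G.colClassGraph (G.compColour a b c) i).CSCounts a b c ∧
      (G.colClassGraph (G.compColour a b c) i).SRa a b c ∧
      (G.colClassGraph (G.compColour a b c) i).SRb a b c) :
    0 ≤ G.slackCF a b c :=
  slackCF_nonneg_of_csCounts (csCounts_of_components a b c h)

end Colouring

end MultiGraph

end PercRepro
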